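import Summits.Ventures.LatticeQCDFlow.Exactness.GaussModeTauIntDichotomy
import Mathlib.MeasureTheory.Integral.Pi
import HarnessLib

/-!
# The volume law of `τ_int` for the free-field flow arm: `τ_int ≤ ½ + 12 (B²/E[g²]) e^{Σ_k u_k/2}`

HONEST FRAMING: exact (Metropolis-corrected) sampling algorithms for lattice gauge theory;
figures of merit are autocorrelation/cost numbers at stated couplings and volumes; no
continuum-physics claim.  (SCALAR calibration rung S0-A: not a gauge result.)

Venture `LatticeQCDFlow` (cell pub-lqcd), topic `Exactness`; FANOUT row 2 (`s0-phi4`, FLOW arm,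
free-field limit of the exactness battery).  NEW WORK of the cell: the universal bound
`τ_int ≤ ½ + 12 (B²/E_π[g²])/κ` of `IMHTauIntLeInvESS.lean` (κ the Kish ESS fraction of the
weights) composed with row 2's closed-form reweighting efficiency of a Gaussian model of `V`
independent Gaussian modes (`Scoring/FreeFieldFlowESS.lean`: `1/κ = Π_k r_k/√(2r_k − 1)`,
`log κ ≥ −½ Σ_k u_k`, `u_k = (r_k − 1)²/(2r_k − 1)`).  Nothing is cited as a fact.

## What is proved (modes `k : ι`, `ι` finite; target `p = ⊗_k N(0, a_k)`, model `q = ⊗_k N(0, b_k)`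
on `ℝ^ι`, `a_k, b_k > 0`, `a_k < 2 b_k`; `r_k = b_k/a_k`; `g` measurable, `|g| ≤ B`, `∫ g p = 0`)

* `gaussProd_facts` — positivity, measurability, integrability, `∫ = 1` of a product Gaussian;
  `gaussProd_weightMoment` — `∫ (p/q) p = Π_k b_k/√(a_k(2b_k − a_k))` (Fubini);
* **`freeFieldFlow_tauInt_le_prod`** — along the exact independence sampler:
  `τ_int(g) ≤ ½ + 12 B² (Π_k b_k/√(a_k(2b_k − a_k))) / ∫ g² p`;
* `prod_invESS_le_exp` — `Π_k b_k/√(a_k(2b_k − a_k)) ≤ exp(½ Σ_k (r_k − 1)²/(2r_k − 1))`;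
* **`freeFieldFlow_tauInt_le_exp`** — THE VOLUME LAW:
  `τ_int(g) ≤ ½ + 12 B² exp(½ Σ_k (r_k − 1)²/(2r_k − 1)) / ∫ g² p`.

Reading for S0-A (no numerics implied): a flow that models each of `V` free-field modes to
relative variance accuracy `ε` (`u_k ≈ ε²`) drives an exact chain whose autocorrelation time of
every observable with `sup g² ≤ E[g²]/θ` is at most `½ + 12 θ⁻¹ e^{Vε²/2}`: bounded in the volume
iff the per-mode accuracy improves like `ε ∝ V^{−1/2}` — the `τ_int` face of the ESS volume law
(`FreeFieldFlowESS`, barrier B1).  NOT CLAIMED: a matching lower bound (the sticking floors of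
`IMHStickingFloorSummed` give one observable by observable, not typed here); `λ > 0`;
correlated-mode models; any number for a trained network.
-/

namespace Summit.Ventures.LatticeQCDFlow.Exactness

open Real MeasureTheory Filter Set Topology ProbabilityTheory
open Summit.Ventures.LatticeQCDFlow.Scoring

variable {ι : Type*} [Fintype ι]

/-- A product of centred Gaussian densities on `ℝ^ι` is positive, measurable, integrable and has
integral `1`. -/
theorem gaussProd_facts (v : ι → NNReal) (hv : ∀ i, v i ≠ 0) :
    (∀ x : ι → ℝ, 0 < ∏ i, gaussianPDFReal 0 (v i) (x i))
    ∧ Measurable (fun x : ι → ℝ => ∏ i, gaussianPDFReal 0 (v i) (x i))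
    ∧ Integrable (fun x : ι → ℝ => ∏ i, gaussianPDFReal 0 (v i) (x i))
    ∧ ∫ x : ι → ℝ, ∏ i, gaussianPDFReal 0 (v i) (x i) = 1 := by
  refine ⟨fun x => Finset.prod_pos fun i _ => gaussianPDFReal_pos 0 (v i) (x i) (hv i), ?_, ?_, ?_⟩
  · exact Finset.measurable_prod _ fun i _ =>
      (measurable_gaussianPDFReal 0 (v i)).comp (measurable_pi_apply i)
  · have h := Integrable.fintype_prod (𝕜 := ℝ) (μ := fun _ : ι => (volume : Measure ℝ))
      (f := fun i => gaussianPDFReal 0 (v i)) fun i => integrable_gaussianPDFReal 0 (v i)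
    rw [← volume_pi] at h
    exact h
  · rw [integral_fintype_prod_volume_eq_prod (f := fun i => gaussianPDFReal 0 (v i))]
    exact Finset.prod_eq_one fun i _ => integral_gaussianPDFReal_eq_one 0 (hv i)

/-- **The second weight moment of a product model factorises (Fubini)**:
`∫ (p/q) p = Π_k ∫ p_k²/q_k = Π_k b_k/√(a_k(2b_k − a_k))` for `a_k < 2b_k`. -/
theorem gaussProd_weightMoment (a b : ι → NNReal) (ha : ∀ i, a i ≠ 0) (hb : ∀ i, b i ≠ 0)
    (hab : ∀ i, ((a i : NNReal) : ℝ) < 2 * b i) :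
    ∫ x : ι → ℝ, (∏ i, gaussianPDFReal 0 (a i) (x i)) / (∏ i, gaussianPDFReal 0 (b i) (x i))
        * ∏ i, gaussianPDFReal 0 (a i) (x i)
      = ∏ i, ((b i : ℝ) / Real.sqrt (a i * (2 * b i - a i))) := by
  have e : ∀ x : ι → ℝ, (∏ i, gaussianPDFReal 0 (a i) (x i)) / (∏ i, gaussianPDFReal 0 (b i) (x i))
      * ∏ i, gaussianPDFReal 0 (a i) (x i)
      = ∏ i, (gaussianPDFReal 0 (a i) (x i) ^ 2 / gaussianPDFReal 0 (b i) (x i)) := by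
    intro x
    rw [← Finset.prod_div_distrib, ← Finset.prod_mul_distrib]
    refine Finset.prod_congr rfl fun i _ => ?_
    have hq : gaussianPDFReal 0 (b i) (x i) ≠ 0 := (gaussianPDFReal_pos 0 (b i) (x i) (hb i)).ne'
    field_simp
  simp_rw [e]
  rw [integral_fintype_prod_volume_eq_prod
    (f := fun i y => gaussianPDFReal 0 (a i) y ^ 2 / gaussianPDFReal 0 (b i) y)]
  exact Finset.prod_congr rfl fun i _ => gaussian_weight_sq_moment (a i) (b i) (ha i) (hb i) (hab i)

/-- **`τ_int ≤ ½ + 12 B² Π_k (b_k/√(a_k(2b_k − a_k))) / ∫ g² p`** for the exact independence sampler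
of `V = |ι|` free-field modes with a product Gaussian model, every bounded centred `g`. -/
theorem freeFieldFlow_tauInt_le_prod (a b : ι → NNReal) (ha : ∀ i, a i ≠ 0) (hb : ∀ i, b i ≠ 0)
    (hab : ∀ i, ((a i : NNReal) : ℝ) < 2 * b i) {g : (ι → ℝ) → ℝ} (hgm : Measurable g) {B : ℝ}
    (hgb : ∀ x, |g x| ≤ B) (hg0 : ∫ x : ι → ℝ, g x * ∏ i, gaussianPDFReal 0 (a i) (x i) = 0) :
    tauInt (fun k => (∫ x : ι → ℝ, g x
        * ((imhOp volume (fun x : ι → ℝ => ∏ i, gaussianPDFReal 0 (a i) (x i))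
            (fun x : ι → ℝ => ∏ i, gaussianPDFReal 0 (b i) (x i)))^[k] g) x
        * ∏ i, gaussianPDFReal 0 (a i) (x i))
        / ∫ x : ι → ℝ, g x ^ 2 * ∏ i, gaussianPDFReal 0 (a i) (x i))
      ≤ 1 / 2 + 12 * B ^ 2 * (∏ i, ((b i : ℝ) / Real.sqrt (a i * (2 * b i - a i))))
          / ∫ x : ι → ℝ, g x ^ 2 * ∏ i, gaussianPDFReal 0 (a i) (x i) := by
  obtain ⟨hp0, hpm, hpi, hp1⟩ := gaussProd_facts a ha
  obtain ⟨hq0, hqm, hqi, hq1⟩ := gaussProd_facts b hb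
  have hW : ∫ x : ι → ℝ, (∏ i, gaussianPDFReal 0 (a i) (x i)) / (∏ i, gaussianPDFReal 0 (b i) (x i))
      * ∏ i, gaussianPDFReal 0 (a i) (x i) = ∏ i, ((b i : ℝ) / Real.sqrt (a i * (2 * b i - a i))) :=
    gaussProd_weightMoment a b ha hb hab
  have hWpos : 0 < ∏ i, ((b i : ℝ) / Real.sqrt (a i * (2 * b i - a i))) := by
    refine Finset.prod_pos fun i _ => ?_
    have ha' : (0 : ℝ) < a i := by exact_mod_cast pos_iff_ne_zero.mpr (ha i)
    have hb' : (0 : ℝ) < b i := by exact_mod_cast pos_iff_ne_zero.mpr (hb i)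
    have : 0 < 2 * (b i : ℝ) - a i := by linarith [hab i]
    positivity
  have hW₂ : Integrable (fun x : ι → ℝ => (∏ i, gaussianPDFReal 0 (a i) (x i))
      / (∏ i, gaussianPDFReal 0 (b i) (x i)) * ∏ i, gaussianPDFReal 0 (a i) (x i)) := by
    by_contra h
    rw [integral_undef h] at hW
    exact hWpos.ne' hW.symm |>.elim
  have h := imhOp_tauInt_le_invESS (μ := volume) hp0 hpm hpi hq0 hqm hqi hq1 hW₂ hgm hgb hg0
  rw [hW, hp1, div_one] at h
  exact h

/-- `Π_k b_k/√(a_k(2b_k − a_k)) ≤ exp(½ Σ_k (r_k − 1)²/(2r_k − 1))`, `r_k = b_k/a_k`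
(each factor is `1/gaussModeESS r_k`, and `log Π gaussModeESS ≥ −½ Σ u`). -/
theorem prod_invESS_le_exp (a b : ι → NNReal) (ha : ∀ i, a i ≠ 0) (hb : ∀ i, b i ≠ 0)
    (hab : ∀ i, ((a i : NNReal) : ℝ) < 2 * b i) :
    ∏ i, ((b i : ℝ) / Real.sqrt (a i * (2 * b i - a i)))
      ≤ Real.exp ((1 / 2) * ∑ i, ((b i : ℝ) / a i - 1) ^ 2 / (2 * ((b i : ℝ) / a i) - 1)) := by
  have ha' : ∀ i, (0 : ℝ) < a i := fun i => by exact_mod_cast pos_iff_ne_zero.mpr (ha i)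
  have hb' : ∀ i, (0 : ℝ) < b i := fun i => by exact_mod_cast pos_iff_ne_zero.mpr (hb i)
  have hr : ∀ i ∈ (Finset.univ : Finset ι), 1 / 2 < (b i : ℝ) / a i := fun i _ => by
    rw [lt_div_iff₀ (ha' i)]
    linarith [hab i]
  have hESSpos : ∀ i, 0 < gaussModeESS ((b i : ℝ) / a i) := fun i => by
    have h2 : 0 < 2 * ((b i : ℝ) / a i) - 1 := by linarith [hr i (Finset.mem_univ i)]
    unfold gaussModeESS
    exact div_pos (Real.sqrt_pos.mpr h2) (div_pos (hb' i) (ha' i))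
  -- each factor is `1/gaussModeESS r`
  have hfac : ∀ i, (b i : ℝ) / Real.sqrt (a i * (2 * b i - a i))
      = (gaussModeESS ((b i : ℝ) / a i))⁻¹ := fun i => by
    rw [gaussian_weight_sq_moment_ratio (a i) (b i) (ha' i) (hab i)]
    unfold gaussModeESS
    rw [inv_div]
  have hlog := log_prod_gaussModeESS_ge (Finset.univ : Finset ι) (fun i => (b i : ℝ) / a i) hr
  calc ∏ i, ((b i : ℝ) / Real.sqrt (a i * (2 * b i - a i)))
      = ∏ i, (gaussModeESS ((b i : ℝ) / a i))⁻¹ := Finset.prod_congr rfl fun i _ => hfac i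
    _ = Real.exp (∑ i, -Real.log (gaussModeESS ((b i : ℝ) / a i))) := by
        rw [Real.exp_sum]
        refine Finset.prod_congr rfl fun i _ => ?_
        rw [Real.exp_neg, Real.exp_log (hESSpos i)]
    _ ≤ Real.exp ((1 / 2) * ∑ i, ((b i : ℝ) / a i - 1) ^ 2 / (2 * ((b i : ℝ) / a i) - 1)) := by
        refine Real.exp_le_exp.2 ?_
        rw [Finset.sum_neg_distrib]
        linarith

/-- **THE VOLUME LAW OF `τ_int` FOR THE FREE-FIELD FLOW ARM.**  `V = |ι|` independent modes, target
`⊗ N(0, a_k)`, Gaussian model `⊗ N(0, b_k)` with `a_k < 2b_k` (`r_k = b_k/a_k > ½`); `g` measurable,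
`|g| ≤ B`, centred.  Along the exact independence sampler:
`τ_int(g) ≤ ½ + 12 B² exp(½ Σ_k (r_k − 1)²/(2r_k − 1)) / ∫ g² p`. -/
theorem freeFieldFlow_tauInt_le_exp (a b : ι → NNReal) (ha : ∀ i, a i ≠ 0) (hb : ∀ i, b i ≠ 0)
    (hab : ∀ i, ((a i : NNReal) : ℝ) < 2 * b i) {g : (ι → ℝ) → ℝ} (hgm : Measurable g) {B : ℝ}
    (hgb : ∀ x, |g x| ≤ B) (hg0 : ∫ x : ι → ℝ, g x * ∏ i, gaussianPDFReal 0 (a i) (x i) = 0) :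
    tauInt (fun k => (∫ x : ι → ℝ, g x
        * ((imhOp volume (fun x : ι → ℝ => ∏ i, gaussianPDFReal 0 (a i) (x i))
            (fun x : ι → ℝ => ∏ i, gaussianPDFReal 0 (b i) (x i)))^[k] g) x
        * ∏ i, gaussianPDFReal 0 (a i) (x i))
        / ∫ x : ι → ℝ, g x ^ 2 * ∏ i, gaussianPDFReal 0 (a i) (x i))
      ≤ 1 / 2 + 12 * B ^ 2
          * Real.exp ((1 / 2) * ∑ i, ((b i : ℝ) / a i - 1) ^ 2 / (2 * ((b i : ℝ) / a i) - 1))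
          / ∫ x : ι → ℝ, g x ^ 2 * ∏ i, gaussianPDFReal 0 (a i) (x i) := by
  obtain ⟨hp0, -, -, -⟩ := gaussProd_facts a ha
  have hA0 : 0 ≤ ∫ x : ι → ℝ, g x ^ 2 * ∏ i, gaussianPDFReal 0 (a i) (x i) :=
    integral_nonneg fun x => mul_nonneg (sq_nonneg _) (hp0 x).le
  refine (freeFieldFlow_tauInt_le_prod a b ha hb hab hgm hgb hg0).trans ?_
  refine add_le_add le_rfl (div_le_div_of_nonneg_right ?_ hA0)
  exact mul_le_mul_of_nonneg_left (prod_invESS_le_exp a b ha hb hab) (by positivity)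

end Summit.Ventures.LatticeQCDFlow.Exactness
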